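import Summits.ValiantsHypothesis.ValiantsHypothesis.Theorems.KPlusLogSqLawTropicalBTwoBoundaryPort

/-!
# Route «KPlusLogSqLaw», crux `TropicalB` (stmt-ValiantsHypothesis-19771) — the TWO-BOUNDARY PORT of SHIFT-THREE, part 2:
# potentials and the polynomial bounds for the junk cells

HONEST FRAMING.  Proof file (pure theorems), seat val-sym-trop-p1 g17 (cell `pub-symmetroid`, 2026-08-28), `--supports stmt-ValiantsHypothesis-19771
--as helper`, toward the registered stubs `stub_tropThin` / `stub_tropFat` of `Cruxes/TropicalB/Lines/birth.lean` (crux `TropicalB`); continuation of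
`…TropicalBTwoBoundaryPort` (split for the 400-line rule).  Contents: every index of `Fin (m + m)` is real or partner (`re_or_pa`), the values of the
certificate potentials `potU` / `potW` on real and partner indices, and the arithmetic bounds used against the `huge` junk cells: `th ≤ 2(n+3)²`,
`D ≤ 2(n+3)²`, `0 ≤ vv ≤ 3(n+3)⁴`, and `G_bounds : −7(n+3)⁴ ≤ G ≤ 8(n+3)⁴` for SHIFT-THREE's corrected grid scores.  Nothing here bounds `TropicalB`
in its window; nothing bears on `WeakLifting`, DoorA26 / DoorA34, `MatrixDescartes` (stmt-ValiantsHypothesis-18050) or VP ≠ VNP.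
-/

set_option linter.dupNamespace false
set_option autoImplicit false

namespace Summit.ValiantsHypothesis.ValiantsHypothesis.Theorems.KPlusLogSqLaw

namespace BoundarySector

namespace TwoPort

open Summit.ValiantsHypothesis.ValiantsHypothesis.Theorems.MatrixDescartes.Negative
open Summit.ValiantsHypothesis.ValiantsHypothesis.Theorems.LacunarySymmetroidMatrixDescartes.TropicalCensus
open Summit.ValiantsHypothesis.ValiantsHypothesis.Theorems.LacunarySymmetroidMatrixDescartes.TropicalCensus.ShiftThree
open Finset

variable (n : ℕ)

/-! ### 5. Every index is real or partner; values of the potentials -/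

/-- every index is real or partner. -/
theorem re_or_pa (y : Fin ((n + 1) + (n + 1))) : (∃ b, y = (Fin.castAdd (n + 1)) b) ∨ (∃ b, y = (Fin.natAdd (n + 1)) b) := by
  obtain ⟨s, rfl⟩ := finSumFinEquiv.surjective y
  rcases s with b | b
  · exact Or.inl ⟨b, finSumFinEquiv_apply_left b⟩
  · exact Or.inr ⟨b, finSumFinEquiv_apply_right b⟩

/-- real and partner indices differ. -/
theorem RE_ne_PA (a b : Fin (n + 1)) : ((Fin.castAdd (n + 1)) a : Fin ((n + 1) + (n + 1))) ≠ (Fin.natAdd (n + 1)) b := by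
  intro h
  have := congrArg Fin.val h
  rw [val_RE, val_PA] at this
  omega

/-- the real embedding is injective. -/
theorem RE_injective : Function.Injective (Fin.castAdd (n + 1) : Fin (n + 1) → Fin ((n + 1) + (n + 1))) :=
  Fin.castAdd_injective _ _

variable (p a : ℕ)

/-- row potential of a real row. -/
theorem potU_RE (a' : Fin (n + 1)) : potU n p a ((Fin.castAdd (n + 1)) a') = -(2 * th n p a * (2 * n + 5) * (a' : ℤ)) := by
  unfold potU; rw [symm_RE]; rfl

/-- row potential of a partner row. -/
theorem potU_PA (b : Fin (n + 1)) :
    potU n p a ((Fin.natAdd (n + 1)) b) = 2 * th n p a - 2 * G n p a b - 2 * th n p a * (2 * n + 5) * (b : ℤ) + 1 := by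
  unfold potU; rw [symm_PA]; rfl

/-- column potential of a real column. -/
theorem potW_RE (b : Fin (n + 1)) :
    potW n p a ((Fin.castAdd (n + 1)) b) = 2 * G n p a b + 2 * th n p a * (2 * n + 5) * (b : ℤ) - (if lam n p a b = 1 then 1 else 0) := by
  unfold potW; rw [symm_RE]; rfl

/-- column potential of a partner column. -/
theorem potW_PA (b : Fin (n + 1)) :
    potW n p a ((Fin.natAdd (n + 1)) b) = 2 * G n p a b - 2 * th n p a + 2 * th n p a * (2 * n + 5) * (b : ℤ) -
      (if lam n p a b = 1 then 0 else 1) := by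
  unfold potW; rw [symm_PA]; rfl

/-! ### 6. Bounds (for the junk cells) -/

variable {n p a}

/-- grid slopes are at most `2(n+3)²`. -/
theorem th_le (hp : p ≤ n) (ha : a + p ≤ n + 1) : th n p a ≤ 2 * ((n : ℤ) + 3) ^ 2 := by
  unfold th
  have h1 : ((2 * n + 4) * p : ℤ) ≤ (2 * n + 4) * n := by
    apply mul_le_mul_of_nonneg_left (by exact_mod_cast hp) (by positivity)
  have h2 : (a : ℤ) ≤ n + 1 := by exact_mod_cast (show a ≤ n + 1 by omega)
  nlinarith

/-- `D ≤ 2(n+3)²`. -/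
theorem bigD_le : (bigD n : ℤ) ≤ 2 * ((n : ℤ) + 3) ^ 2 := by unfold bigD; push_cast; nlinarith

/-- every exponent is at most `D`. -/
theorem dd_le (l : Fin 3) : (dd n l : ℤ) ≤ bigD n := by
  have h := one_lt_bigD n
  fin_cases l
  · show ((![0, 1, bigD n] 0 : ℕ) : ℤ) ≤ bigD n; simp
  · show ((![0, 1, bigD n] 1 : ℕ) : ℤ) ≤ bigD n; simp; omega
  · show ((![0, 1, bigD n] 2 : ℕ) : ℤ) ≤ bigD n; simp

/-- penalties are non-negative. -/
theorem pen_nonneg (b' b : Fin (n + 1)) : 0 ≤ pen n (shiftZ n b' b) := by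
  have h0 := shiftZ_nonneg n b' b
  unfold pen; positivity

/-- penalties are at most `2(n+3)⁴`. -/
theorem pen_le (b' b : Fin (n + 1)) : pen n (shiftZ n b' b) ≤ 2 * ((n : ℤ) + 3) ^ 4 := by
  have h0 := shiftZ_nonneg n b' b
  have h1 := shiftZ_le n b' b
  unfold pen
  set q := shiftZ n b' b
  have h2 : q * (q + 1) ≤ ((n : ℤ) + 3) * ((n : ℤ) + 3) := by nlinarith
  have h3 : (2 * (n : ℤ) + 5) * (n + 2) ≤ 2 * (((n : ℤ) + 3) * ((n : ℤ) + 3)) := by nlinarith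
  calc (2 * (n : ℤ) + 5) * (n + 2) * (q * (q + 1))
      ≤ (2 * (((n : ℤ) + 3) * ((n : ℤ) + 3))) * (((n : ℤ) + 3) * ((n : ℤ) + 3)) :=
        mul_le_mul h3 h2 (by positivity) (by positivity)
    _ = 2 * ((n : ℤ) + 3) ^ 4 := by ring

/-- prices are at most `2(n+3)²`. -/
theorem price_le (b' b : Fin (n + 1)) : price n (shiftZ n b' b) b ≤ 2 * ((n : ℤ) + 3) ^ 2 := by
  have h1 := shiftZ_le n b' b
  have hb : ((b : ℕ) : ℤ) ≤ n := by exact_mod_cast (Nat.lt_succ_iff.mp b.isLt)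
  unfold price
  have h2 : ((2 * n + 4) * shiftZ n b' b : ℤ) ≤ (2 * n + 4) * n :=
    mul_le_mul_of_nonneg_left h1 (by positivity)
  nlinarith

/-- SHIFT-THREE valuations are non-negative. -/
theorem vv_nonneg (b' b : Fin (n + 1)) (l : Fin 3) : 0 ≤ vv n b' b l := by
  have h1 := pen_nonneg b' b
  have h2 := (price_pos n b' b).le
  unfold vv; split_ifs <;> linarith

/-- SHIFT-THREE valuations are at most `3(n+3)⁴`. -/
theorem vv_le (b' b : Fin (n + 1)) (l : Fin 3) : vv n b' b l ≤ 3 * ((n : ℤ) + 3) ^ 4 := by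
  have h1 := pen_le b' b
  have h2 := price_le b' b
  have hN : (3 : ℤ) ≤ (n : ℤ) + 3 := by linarith [Int.natCast_nonneg n]
  have h9 : (9 : ℤ) ≤ ((n : ℤ) + 3) ^ 2 := by nlinarith
  have hN2 : 2 * ((n : ℤ) + 3) ^ 2 ≤ ((n : ℤ) + 3) ^ 4 := by
    have e : ((n : ℤ) + 3) ^ 4 = ((n : ℤ) + 3) ^ 2 * ((n : ℤ) + 3) ^ 2 := by ring
    rw [e]; nlinarith
  unfold vv; split_ifs <;> nlinarith

/-- the grid scores are polynomially bounded: `−7(n+3)⁴ ≤ G ≤ 8(n+3)⁴`. -/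
theorem G_bounds (hp : p ≤ n) (ha : a + p ≤ n + 1) (b : Fin (n + 1)) :
    -(7 * ((n : ℤ) + 3) ^ 4) ≤ G n p a b ∧ G n p a b ≤ 8 * ((n : ℤ) + 3) ^ 4 := by
  set N := (n : ℤ) + 3 with hNdef
  have hN : (3 : ℤ) ≤ N := by rw [hNdef]; linarith [Int.natCast_nonneg n]
  have hθ1 := th_pos n p a
  have hθ2 := th_le hp ha
  have hD1 := one_lt_bigD n
  have hD2 := bigD_le (n := n)
  set θ := th n p a
  set b' := rot n p b
  set l := lam n p a b
  have hdd0 : (0 : ℤ) ≤ (dd n l : ℤ) := by positivity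
  have hdd1 := dd_le (n := n) l
  have hv0 := vv_nonneg b' b l
  have hv1 := vv_le b' b l
  have hs0 := shiftZ_nonneg n b' b
  have hs1 : shiftZ n b' b ≤ N := by have := shiftZ_le n b' b; rw [hNdef]; linarith
  have hc : (2 * (n : ℤ) + 5) ≤ 2 * N := by rw [hNdef]; linarith
  have e : G n p a b = θ * (dd n l : ℤ) - vv n b' b l + θ * (2 * n + 5) * shiftZ n b' b -
      θ * (bigD n : ℤ) * (if (b' : ℕ) < (b : ℕ) then 1 else 0) := rfl
  have h1 : θ * (dd n l : ℤ) ≤ (2 * N ^ 2) * (2 * N ^ 2) := mul_le_mul hθ2 (hdd1.trans hD2) hdd0 (by positivity)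
  have h2 : θ * (2 * n + 5) * shiftZ n b' b ≤ (2 * N ^ 2) * (2 * N) * N :=
    mul_le_mul (mul_le_mul hθ2 hc (by positivity) (by positivity)) hs1 hs0 (by positivity)
  have h3 : 0 ≤ θ * (dd n l : ℤ) := by positivity
  have h4 : 0 ≤ θ * (2 * n + 5) * shiftZ n b' b := by positivity
  have h5 : 0 ≤ θ * (bigD n : ℤ) * (if (b' : ℕ) < (b : ℕ) then 1 else 0) := by positivity
  have h6 : θ * (bigD n : ℤ) * (if (b' : ℕ) < (b : ℕ) then 1 else 0) ≤ (2 * N ^ 2) * (2 * N ^ 2) := by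
    have h7 : (if (b' : ℕ) < (b : ℕ) then (1 : ℤ) else 0) ≤ 1 := by split_ifs <;> norm_num
    calc θ * (bigD n : ℤ) * (if (b' : ℕ) < (b : ℕ) then 1 else 0) ≤ θ * (bigD n : ℤ) * 1 :=
          mul_le_mul_of_nonneg_left h7 (by positivity)
      _ ≤ (2 * N ^ 2) * (2 * N ^ 2) := by rw [mul_one]; exact mul_le_mul hθ2 hD2 (by positivity) (by positivity)
  constructor <;> nlinarith

end TwoPort

end BoundarySector

end Summit.ValiantsHypothesis.ValiantsHypothesis.Theorems.KPlusLogSqLaw
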